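import Summits.AnomalousDissipation.AnomalousDissipation.Theorems.SolenoidalFractalHomogenisationLagrangianStepVmodFlatBlocks
import HarnessLib

/-!
# K1L_D (stmt-AnomalousDissipation-27980): (V_mod) flat stage — the SUPPORT-SPLIT REDUCTION of a block pairing (class diagonalisation (R-b)/(R-c)
# of the certifier's regime table, abstract form)
(line file of the (V_mod) lane; prover ad-k3l-bookkeeping-p1 g9; pure `V2` algebra, no PDE.)

A block of `VmodFlat.BlockBound` bounds `|⟪U x − T x, ζ⟫|` by `η·√(lossFwd T x)·√(lossAdj T ζ)` for the two window maps `U = U s t` (cell member)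
and `T = T s t` (coarse member).  When a symmetric frequency set `A` and its complement are BOTH preserved by `U` (Bloch-class unions along the
periodic cell carrier: this seat's `IsPropagator.mFourierCoeff_apply_eq_zero_of_multiplier`, `…VmodFFAllFast`) and `T` and its adjoint act
modewise (`VmodFlat.coarseSupp`), the pairing and the two losses SPLIT over `A ⊕ Aᶜ` (label projector `exists_labelProj`, Parseval orthogonality),
so a bound on each piece gives the bound on all data with `η = max η_A η_B`:
* `sqrt_mul_sqrt_add_le` — `√a√c + √b√d ≤ √(a+b)·√(c+d)`;
* **`pairing_le_of_support_split`** — the reduction, for data/test classes given by VANISHING SETS (`∀ k ∈ Z, fc x k = 0`; `IsSlow`/`IsFast` are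
  of this form), which label projectors preserve.
Iterating it splits the (ff)/(fs)/(sf)/(ss) pairings over any finite family of class unions (e.g. «no slow mate» ⊕ «slow mate», coarse ⊕ high).
`sorry`-free; NOT a proof of any block, of the stub, of K1L_D or AD; rung F-D1.A0.
-/

set_option linter.dupNamespace false

noncomputable section

namespace Summit.AnomalousDissipation.AnomalousDissipation.Theorems.SolenoidalFractalHomogenisation.LagrangianStep.VmodFlat

open Literature.Analysis Literature.Analysis.FluidPDE Literature.Analysis.FunctionSpaces
open MeasureTheory Set Filter UnitAddTorus
open scoped ENNReal NNReal InnerProductSpace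
open Summit.AnomalousDissipation.AnomalousDissipation.Theorems.SolenoidalFractalHomogenisation.LagrangianStep.CellClauseMod
open Summit.AnomalousDissipation.AnomalousDissipation.Theorems.SolenoidalFractalHomogenisation.LagrangianStep.LossCurrency

/-- Two-term Cauchy–Schwarz: `√a·√c + √b·√d ≤ √(a+b)·√(c+d)` for nonnegative reals. [folklore] -/
theorem sqrt_mul_sqrt_add_le {a b c d : ℝ} (ha : 0 ≤ a) (hb : 0 ≤ b) (hc : 0 ≤ c) (hd : 0 ≤ d) :
    Real.sqrt a * Real.sqrt c + Real.sqrt b * Real.sqrt d ≤ Real.sqrt (a + b) * Real.sqrt (c + d) := by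
  have h := Real.sum_mul_le_sqrt_mul_sqrt (Finset.univ : Finset (Fin 2)) (fun i => if i = 0 then Real.sqrt a else Real.sqrt b)
    (fun i => if i = 0 then Real.sqrt c else Real.sqrt d)
  simp only [Fin.sum_univ_two, Fin.isValue, ↓reduceIte, one_ne_zero] at h
  rw [Real.sq_sqrt ha, Real.sq_sqrt hb, Real.sq_sqrt hc, Real.sq_sqrt hd] at h
  exact h

/-- **THE SUPPORT-SPLIT REDUCTION.**  Let `A ⊆ ℤ³` be symmetric, `Uop, Top : V2 →L V2` with `Uop` preserving `A`-supported AND `Aᶜ`-supported data,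
`Top` and its adjoint acting modewise (vanishing coefficients stay vanishing), `Top` a contraction; let the data class `∀ k ∈ Zx, fc x k = 0` and the
test class `∀ k ∈ Zζ, fc ζ k = 0` be given by vanishing sets.  If `|⟪Uop x − Top x, ζ⟫| ≤ η_A·√(lossFwd Top x)·√(lossAdj Top ζ)` for `A`-supported
members of the classes and `≤ η_B·…` for `Aᶜ`-supported members, then `≤ max η_A η_B·…` for ALL members. [folklore] -/
theorem pairing_le_of_support_split (A : Set (Fin 3 → ℤ)) (hA : ∀ k, k ∈ A ↔ -k ∈ A) {Uop Top : V2 →L[ℝ] V2}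
    (hUA : ∀ x : V2, (∀ k, k ∉ A → fc x k = 0) → ∀ k, k ∉ A → fc (Uop x) k = 0)
    (hUB : ∀ x : V2, (∀ k, k ∈ A → fc x k = 0) → ∀ k, k ∈ A → fc (Uop x) k = 0)
    (hT : ∀ (x : V2) (k : Fin 3 → ℤ), fc x k = 0 → fc (Top x) k = 0 ∧ fc (ContinuousLinearMap.adjoint Top x) k = 0)
    (hTc : ∀ x, ‖Top x‖ ≤ ‖x‖) (Zx Zζ : Set (Fin 3 → ℤ)) {ηA ηB : ℝ} (hηA : 0 ≤ ηA)
    (hbA : ∀ x ζ : V2, (∀ k, k ∉ A → fc x k = 0) → (∀ k, k ∉ A → fc ζ k = 0) → (∀ k ∈ Zx, fc x k = 0) → (∀ k ∈ Zζ, fc ζ k = 0) →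
      |⟪Uop x - Top x, ζ⟫_ℝ| ≤ ηA * Real.sqrt (lossFwd Top x) * Real.sqrt (lossAdj Top ζ))
    (hbB : ∀ x ζ : V2, (∀ k, k ∈ A → fc x k = 0) → (∀ k, k ∈ A → fc ζ k = 0) → (∀ k ∈ Zx, fc x k = 0) → (∀ k ∈ Zζ, fc ζ k = 0) →
      |⟪Uop x - Top x, ζ⟫_ℝ| ≤ ηB * Real.sqrt (lossFwd Top x) * Real.sqrt (lossAdj Top ζ))
    (x ζ : V2) (hx : ∀ k ∈ Zx, fc x k = 0) (hζ : ∀ k ∈ Zζ, fc ζ k = 0) :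
    |⟪Uop x - Top x, ζ⟫_ℝ| ≤ max ηA ηB * Real.sqrt (lossFwd Top x) * Real.sqrt (lossAdj Top ζ) := by
  classical
  obtain ⟨P, hP⟩ := exists_labelProj A hA
  -- the split
  have hPon : ∀ (y : V2) k, k ∈ A → fc (P y) k = fc y k := fun y k hk => by
    have h := hP y k; rw [if_pos hk] at h; exact h
  have hPoff : ∀ (y : V2) k, k ∉ A → fc (P y) k = 0 := fun y k hk => by
    have h := hP y k; rw [if_neg hk] at h; exact h
  set xA : V2 := P x with hxA
  set xB : V2 := x - P x with hxB
  set ζA : V2 := P ζ with hζA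
  set ζB : V2 := ζ - P ζ with hζB
  have hxsplit : x = xA + xB := by rw [hxA, hxB]; abel
  have hζsplit : ζ = ζA + ζB := by rw [hζA, hζB]; abel
  -- supports of the pieces
  have hxA_off : ∀ k, k ∉ A → fc xA k = 0 := fun k hk => hPoff x k hk
  have hζA_off : ∀ k, k ∉ A → fc ζA k = 0 := fun k hk => hPoff ζ k hk
  have hxB_on : ∀ k, k ∈ A → fc xB k = 0 := fun k hk => by rw [hxB, fc_sub, hPon x k hk, sub_self]
  have hζB_on : ∀ k, k ∈ A → fc ζB k = 0 := fun k hk => by rw [hζB, fc_sub, hPon ζ k hk, sub_self]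
  -- the vanishing sets pass to the pieces
  have hxA_Z : ∀ k ∈ Zx, fc xA k = 0 := fun k hk => by
    by_cases hkA : k ∈ A
    · rw [hxA, hPon x k hkA]; exact hx k hk
    · exact hPoff x k hkA
  have hxB_Z : ∀ k ∈ Zx, fc xB k = 0 := fun k hk => by
    by_cases hkA : k ∈ A
    · exact hxB_on k hkA
    · rw [hxB, fc_sub, hPoff x k hkA, sub_zero]; exact hx k hk
  have hζA_Z : ∀ k ∈ Zζ, fc ζA k = 0 := fun k hk => by
    by_cases hkA : k ∈ A
    · rw [hζA, hPon ζ k hkA]; exact hζ k hk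
    · exact hPoff ζ k hkA
  have hζB_Z : ∀ k ∈ Zζ, fc ζB k = 0 := fun k hk => by
    by_cases hkA : k ∈ A
    · exact hζB_on k hkA
    · rw [hζB, fc_sub, hPoff ζ k hkA, sub_zero]; exact hζ k hk
  -- supports after the maps
  have hDA_off : ∀ k, k ∉ A → fc (Uop xA - Top xA) k = 0 := fun k hk => by
    rw [fc_sub, hUA xA hxA_off k hk, (hT xA k (hxA_off k hk)).1, sub_zero]
  have hDB_on : ∀ k, k ∈ A → fc (Uop xB - Top xB) k = 0 := fun k hk => by
    rw [fc_sub, hUB xB hxB_on k hk, (hT xB k (hxB_on k hk)).1, sub_zero]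
  -- the cross pairings vanish
  have hcross₁ : ⟪Uop xA - Top xA, ζB⟫_ℝ = 0 := inner_eq_zero_of_fc_disjoint fun k => by
    by_cases hk : k ∈ A
    · exact Or.inr (hζB_on k hk)
    · exact Or.inl (hDA_off k hk)
  have hcross₂ : ⟪Uop xB - Top xB, ζA⟫_ℝ = 0 := inner_eq_zero_of_fc_disjoint fun k => by
    by_cases hk : k ∈ A
    · exact Or.inl (hDB_on k hk)
    · exact Or.inr (hζA_off k hk)
  have hlin : Uop x - Top x = (Uop xA - Top xA) + (Uop xB - Top xB) := by
    rw [hxsplit, map_add, map_add]; abel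
  have hpair : ⟪Uop x - Top x, ζ⟫_ℝ = ⟪Uop xA - Top xA, ζA⟫_ℝ + ⟪Uop xB - Top xB, ζB⟫_ℝ := by
    rw [hlin, hζsplit, inner_add_left, inner_add_right, inner_add_right, hcross₁, hcross₂]; ring
  -- additivity of the two losses over the split
  have hox : ⟪xA, xB⟫_ℝ = 0 := inner_eq_zero_of_fc_disjoint fun k => by
    by_cases hk : k ∈ A
    · exact Or.inr (hxB_on k hk)
    · exact Or.inl (hxA_off k hk)
  have hoTx : ⟪Top xA, Top xB⟫_ℝ = 0 := inner_eq_zero_of_fc_disjoint fun k => by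
    by_cases hk : k ∈ A
    · exact Or.inr ((hT xB k (hxB_on k hk)).1)
    · exact Or.inl ((hT xA k (hxA_off k hk)).1)
  have hoζ : ⟪ζA, ζB⟫_ℝ = 0 := inner_eq_zero_of_fc_disjoint fun k => by
    by_cases hk : k ∈ A
    · exact Or.inr (hζB_on k hk)
    · exact Or.inl (hζA_off k hk)
  have hoAζ : ⟪ContinuousLinearMap.adjoint Top ζA, ContinuousLinearMap.adjoint Top ζB⟫_ℝ = 0 :=
    inner_eq_zero_of_fc_disjoint fun k => by
      by_cases hk : k ∈ A
      · exact Or.inr ((hT ζB k (hζB_on k hk)).2)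
      · exact Or.inl ((hT ζA k (hζA_off k hk)).2)
  have hq_add : lossFwd Top x = lossFwd Top xA + lossFwd Top xB := by
    unfold lossFwd; rw [hxsplit]; exact loss_add_of_orthogonal hox hoTx
  have hqs_add : lossAdj Top ζ = lossAdj Top ζA + lossAdj Top ζB := by
    unfold lossAdj; rw [hζsplit]; exact loss_add_of_orthogonal hoζ hoAζ
  have hq0 : ∀ y, 0 ≤ lossFwd Top y := fun y => loss_nonneg hTc y
  have hqs0 : ∀ y, 0 ≤ lossAdj Top y := fun y => lossAdj_nonneg hTc y
  -- the two piece bounds and the assembly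
  have bA := hbA xA ζA hxA_off hζA_off hxA_Z hζA_Z
  have bB := hbB xB ζB hxB_on hζB_on hxB_Z hζB_Z
  have hη : 0 ≤ max ηA ηB := le_max_of_le_left hηA
  rw [hpair]
  calc |⟪Uop xA - Top xA, ζA⟫_ℝ + ⟪Uop xB - Top xB, ζB⟫_ℝ|
      ≤ |⟪Uop xA - Top xA, ζA⟫_ℝ| + |⟪Uop xB - Top xB, ζB⟫_ℝ| := abs_add_le _ _
    _ ≤ ηA * Real.sqrt (lossFwd Top xA) * Real.sqrt (lossAdj Top ζA) +
          ηB * Real.sqrt (lossFwd Top xB) * Real.sqrt (lossAdj Top ζB) := add_le_add bA bB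
    _ ≤ max ηA ηB * (Real.sqrt (lossFwd Top xA) * Real.sqrt (lossAdj Top ζA)) +
          max ηA ηB * (Real.sqrt (lossFwd Top xB) * Real.sqrt (lossAdj Top ζB)) := by
        have h1 : ηA * Real.sqrt (lossFwd Top xA) * Real.sqrt (lossAdj Top ζA) ≤
            max ηA ηB * (Real.sqrt (lossFwd Top xA) * Real.sqrt (lossAdj Top ζA)) := by
          rw [mul_assoc]; exact mul_le_mul_of_nonneg_right (le_max_left _ _) (by positivity)
        have h2 : ηB * Real.sqrt (lossFwd Top xB) * Real.sqrt (lossAdj Top ζB) ≤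
            max ηA ηB * (Real.sqrt (lossFwd Top xB) * Real.sqrt (lossAdj Top ζB)) := by
          rw [mul_assoc]; exact mul_le_mul_of_nonneg_right (le_max_right _ _) (by positivity)
        exact add_le_add h1 h2
    _ = max ηA ηB * (Real.sqrt (lossFwd Top xA) * Real.sqrt (lossAdj Top ζA) +
          Real.sqrt (lossFwd Top xB) * Real.sqrt (lossAdj Top ζB)) := by ring
    _ ≤ max ηA ηB * (Real.sqrt (lossFwd Top x) * Real.sqrt (lossAdj Top ζ)) := by
        refine mul_le_mul_of_nonneg_left ?_ hη
        rw [hq_add, hqs_add]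
        exact sqrt_mul_sqrt_add_le (hq0 xA) (hq0 xB) (hqs0 ζA) (hqs0 ζB)
    _ = max ηA ηB * Real.sqrt (lossFwd Top x) * Real.sqrt (lossAdj Top ζ) := by ring

end Summit.AnomalousDissipation.AnomalousDissipation.Theorems.SolenoidalFractalHomogenisation.LagrangianStep.VmodFlat

end
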